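import Mathlib
import Literature.MathematicalPhysics.QuantumFieldTheory.ConstructiveQFTWave0

/-!
# Sketch — crux-ideate round 1 (rev 3), ideator 1, crux `RobustYangMillsRG` (stmt-QuantumFields-17812)

Card `pinned-corner-isotropy`: the FIRST LEMMA of the line, in its abelianised (Lie-algebra /
small-field) caricature, over the tree's torus types `Site d M = Fin d → ZMod M`.

Every cor-covariant local blocking `Bl` (clause (h1)/(h2) of `AdmAt`) factors as
`Bl U (y, μ) = D_{y,μ}(U) · S_{y,μ}(U)` with `S` the straight transport between the PINNED corners
`cor y → cor (y + e_μ)` and `D` an adjoint-covariant local dressing at `cor y`. On a smooth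
background of (abelianised) curvature `F`, the block plaquette angle is therefore
`(area between pinned corners) · F + (dδ)(y; μ, ν)`, where `δ y μ` is the dressing's phase and
`dδ` its lattice coboundary. The two lemmas below are the two halves of
"the zero-momentum curvature response of every admissible blocking is the identity":

* `sum_cobd_eq_zero` — dressings drop out at zero momentum: the torus sum of the coboundary of ANY
  dressing vanishes in every plane (telescoping over the block torus);
* `stokes_rectangle` — pinned straight transport sees exactly the enclosed fine flux: the sum of
  the fine plaquette curls over an `m × n` rectangle is the boundary holonomy (lattice Stokes), so a
  constant fine curvature `F` gives block plaquette angle `m n F` whatever the transverse averaging.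

Combined with the landed `Sketch.HypercubicQuadraticForms` (B₄-invariant quadratic forms in the plane
variables are multiples of `Σ_s F_s²`) and (h1)-symmetry of the fine weight `w`, the infrared
stiffness tensor of every REALISABLE coercive-format member is scalar — see the card.
-/

open scoped BigOperators
open Literature.MathematicalPhysics.QuantumFieldTheory

namespace Summit.QuantumFields.QCD.Cruxes.RobustYangMillsRG.PinnedCornerIsotropy

section Dressing

variable {d M : ℕ} [NeZero M]

/-- The block curvature induced in plane `(μ, ν)` at block site `y` by an (abelianised) block-link
dressing `δ : Site d M → Fin d → ℝ`: the lattice coboundary of the 1-cochain `δ`. -/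
def cobd (δ : Site d M → Fin d → ℝ) (y : Site d M) (μ ν : Fin d) : ℝ :=
  δ y μ + δ (y + Pi.single μ 1) ν - δ (y + Pi.single ν 1) μ - δ y ν

/-- **Dressings drop out at zero momentum.** Summed over the block torus, the curvature induced by
ANY dressing vanishes in every plane: the zero-momentum curvature response of a cor-pinned covariant
blocking does not depend on its dressing (inhomogeneous, anisotropic, non-translation-covariant
dressings included). [folklore: telescoping on the torus] -/
theorem sum_cobd_eq_zero (δ : Site d M → Fin d → ℝ) (μ ν : Fin d) :
    ∑ y : Site d M, cobd δ y μ ν = 0 := by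
  unfold cobd
  simp only [Finset.sum_sub_distrib, Finset.sum_add_distrib]
  have h1 : ∑ y : Site d M, δ (y + Pi.single μ 1) ν = ∑ y : Site d M, δ y ν :=
    Fintype.sum_equiv (Equiv.addRight (Pi.single μ 1)) _ _ (fun _ => rfl)
  have h2 : ∑ y : Site d M, δ (y + Pi.single ν 1) μ = ∑ y : Site d M, δ y μ :=
    Fintype.sum_equiv (Equiv.addRight (Pi.single ν 1)) _ _ (fun _ => rfl)
  rw [h1, h2]
  ring

/-- The plane-averaged curvature response is dressing-independent: two dressings `δ₁, δ₂` of the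
same pinned straight transport give block curvatures with the same torus sum in every plane. -/
theorem sum_cobd_congr (δ₁ δ₂ : Site d M → Fin d → ℝ) (μ ν : Fin d) :
    ∑ y : Site d M, cobd δ₁ y μ ν = ∑ y : Site d M, cobd δ₂ y μ ν := by
  rw [sum_cobd_eq_zero, sum_cobd_eq_zero]

end Dressing

section Stokes

/-- **Lattice Stokes for a pinned rectangle.** Fine horizontal link phases `a i j` (link from
`(i,j)` to `(i+1,j)`) and vertical ones `b i j` (from `(i,j)` to `(i,j+1)`); the fine plaquette curl
at `(i,j)` is `a i j + b (i+1) j - a i (j+1) - b i j`. Summed over the `m × n` rectangle of fine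
plaquettes spanned by a block plaquette whose four corners are PINNED at `(0,0), (m,0), (m,n),
(0,n)`, the curls telescope to the boundary holonomy of the straight transports. Hence on a
background of constant fine curvature `F` every pinned blocking's plaquette angle is `m·n·F` plus a
dressing coboundary (previous section): unit zero-momentum form factor. [folklore] -/
theorem stokes_rectangle (a b : ℕ → ℕ → ℝ) (m n : ℕ) :
    ∑ i ∈ Finset.range m, ∑ j ∈ Finset.range n, (a i j + b (i + 1) j - a i (j + 1) - b i j)
      = (∑ i ∈ Finset.range m, (a i 0 - a i n))
        + ∑ j ∈ Finset.range n, (b m j - b 0 j) := by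
  have hrow : ∀ i, ∑ j ∈ Finset.range n, (a i j + b (i + 1) j - a i (j + 1) - b i j)
      = (a i 0 - a i n) + ∑ j ∈ Finset.range n, (b (i + 1) j - b i j) := by
    intro i
    have : ∀ j, a i j + b (i + 1) j - a i (j + 1) - b i j
        = (a i j - a i (j + 1)) + (b (i + 1) j - b i j) := fun j => by ring
    simp_rw [this, Finset.sum_add_distrib, Finset.sum_range_sub']
  simp_rw [hrow, Finset.sum_add_distrib]
  congr 1
  rw [Finset.sum_comm]
  refine Finset.sum_congr rfl fun j _ => ?_
  exact Finset.sum_range_sub (fun i => b i j) m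

/-- Constant curvature: if every fine curl in the rectangle equals `F`, the boundary holonomy of the
pinned straight transports is `m * n * F` — the block plaquette angle is the enclosed area times `F`,
independently of how the blocking averages transversally. -/
theorem stokes_rectangle_const (a b : ℕ → ℕ → ℝ) (m n : ℕ) (F : ℝ)
    (hF : ∀ i j, a i j + b (i + 1) j - a i (j + 1) - b i j = F) :
    (∑ i ∈ Finset.range m, (a i 0 - a i n)) + ∑ j ∈ Finset.range n, (b m j - b 0 j)
      = m * n * F := by
  rw [← stokes_rectangle]
  simp_rw [hF, Finset.sum_const, Finset.card_range, nsmul_eq_mul]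
  ring

end Stokes

end Summit.QuantumFields.QCD.Cruxes.RobustYangMillsRG.PinnedCornerIsotropy
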